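import Mathlib
import Summits.Ventures.PercRepro2.HullPieceFlip
import Summits.Ventures.PercRepro2.LocRows2
import Summits.Ventures.PercRepro2.LocSym
import Summits.Ventures.PercRepro2.LocPairing
import Summits.Ventures.PercRepro2.LocPairingCombo

/-!
# The piece-confined pairing on the trivial-core class (blind cell PercRepro2, night-4)

When every configuration has core `{l}` — e.g. when `l` has at most one incident edge — every
piece is non-critical and the colour swap of the piece flip, `τ ζ := blue (flipO ζ)`, is a
(PAIR-combo) involution of `M₀ = {h ∉ H_l, o ∈ B_side}`:

* `τ` is an involution (`flipO_flipO` on `Good`, the piece being preserved);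
* `ζ` and `τ ζ` agree exactly on the edges touching the piece of `o`, which lies in `C_B(l)(ζ)` and
  in `C_B(l)(τ ζ) = C_R(l)(flipO ζ) = C_R(l)(ζ) ∪ P_o` (`PairRel`, `ComboRel`).

This is Theorem B (HullTheoremA) in the pairing vocabulary: `pairCombo_of_core_eq`, and its
instance `pairCombo_of_edges_at_root` for a root with at most one incident edge. The content of the
pairing conjecture lies outside this class (non-trivial cores: `NEG-49/50`, the critical pieces).
-/

namespace Summit.Ventures.PercRepro2

namespace LocRows

open Hull

variable {V : Type*} {E : Type*} [Fintype E] [DecidableEq E]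

open scoped Classical

variable {ends : E → Sym2 V} {l h o : V}

/-- Membership in the principal source set, unfolded. -/
lemma mem_src_principal {ζ : Config E} :
    ζ ∈ srcU ends l h {S : Set V | o ∈ S} ↔
      h ∉ hull ends ζ l ∧ o ∈ cluster ends (blue ζ) l ∧ o ∉ cluster ends ζ l := by
  simp only [srcU, Finset.mem_filter, Finset.mem_univ, true_and, Set.mem_setOf_eq]

omit [Fintype E] [DecidableEq E] in
/-- A source configuration has `o` on the blue side. -/
lemma bside_of_mem_src {ζ : Config E}
    (hζ : h ∉ hull ends ζ l ∧ o ∈ cluster ends (blue ζ) l ∧ o ∉ cluster ends ζ l) :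
    o ∈ bside ends ζ l :=
  ⟨hζ.2.1, hζ.2.2⟩

/-- The swap of the piece flip maps the principal source set to itself when the core is `{l}`. -/
lemma blue_flipO_mem_src (hK : ∀ ζ : Config E, core ends ζ l = {l}) {ζ : Config E}
    (hζ : ζ ∈ srcU ends l h {S : Set V | o ∈ S}) :
    blue (flipO ends ζ l o) ∈ srcU ends l h {S : Set V | o ∈ S} := by
  rw [mem_src_principal] at hζ ⊢
  have hB : o ∈ bside ends ζ l := bside_of_mem_src hζ
  have hnc : NonCritRed ends (blue ζ) l (piece ends ζ l o) :=
    nonCritRed_of_core_eq (ζ := blue ζ) (by rw [core_blue]; exact hK ζ) _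
  obtain ⟨hR, -, -, hH, -⟩ := flipO_blue_case hB hnc
  refine ⟨?_, ?_, ?_⟩
  · rw [hull_blue, hH]; exact hζ.1
  · rw [blue_blue]; exact hR.1
  · exact hR.2

/-- With core `{l}` the piece flip is an involution on the source set, up to the colour swap. -/
lemma blue_flipO_blue_flipO (hK : ∀ ζ : Config E, core ends ζ l = {l}) {ζ : Config E}
    (hζ : ζ ∈ srcU ends l h {S : Set V | o ∈ S}) :
    blue (flipO ends (blue (flipO ends ζ l o)) l o) = ζ := by
  rw [mem_src_principal] at hζ
  have hg : Good ends ζ l o := (good_iff_of_core_eq (hK ζ)).2 (Or.inr (bside_of_mem_src hζ))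
  rw [flipO_blue, blue_blue]
  exact flipO_flipO hg

omit [Fintype E] [DecidableEq E] in
/-- An edge on which `ζ` and `blue (flipO ζ)` agree touches the piece of `o`. -/
lemma mem_touches_piece_of_agree {ζ : Config E} {e : E}
    (he : ζ e = blue (flipO ends ζ l o) e) : e ∈ touches ends (piece ends ζ l o) := by
  by_contra ht
  have h1 : flipO ends ζ l o e = ζ e := flip_apply_of_notMem ht
  rw [blue_apply, h1] at he
  cases ζ e <;> simp at he

omit [Fintype E] [DecidableEq E] in
/-- An edge touching the piece of `o` is an agreement edge of `ζ` and `blue (flipO ζ)`. -/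
lemma agree_of_mem_touches_piece {ζ : Config E} {e : E}
    (ht : e ∈ touches ends (piece ends ζ l o)) : ζ e = blue (flipO ends ζ l o) e := by
  have h1 : flipO ends ζ l o e = !ζ e := flip_apply_of_mem ht
  rw [blue_apply, h1, Bool.not_not]

/-- The pairing relation between `ζ` and the swap of its piece flip (no core hypothesis needed). -/
lemma pairRel_blue_flipO {ζ : Config E}
    (hζ : ζ ∈ srcU ends l h {S : Set V | o ∈ S}) :
    PairRel ends l ζ (blue (flipO ends ζ l o)) := by
  rw [mem_src_principal] at hζ
  have hB : o ∈ bside ends ζ l := bside_of_mem_src hζ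
  intro e he
  obtain ⟨x, hx, y, hends⟩ := mem_touches_piece_of_agree he
  refine ⟨⟨x, piece_subset_cluster_blue hB hx, y, hends⟩, ⟨x, ?_, y, hends⟩⟩
  -- `C_B(l)(blue (flipO ζ)) = C_R(l)(flipO ζ) = C_R(l)(ζ) ∪ P_o`
  rw [blue_blue]
  show x ∈ cluster ends (flip ends (piece ends ζ l o) ζ) l
  rw [cluster_flip_bside_eq hB]
  exact Or.inr hx

/-- The piece-confined clause between `ζ` and the swap of its piece flip (core `{l}`). -/
lemma comboRel_blue_flipO (hK : ∀ ζ : Config E, core ends ζ l = {l}) {ζ : Config E}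
    (hζ : ζ ∈ srcU ends l h {S : Set V | o ∈ S}) :
    ComboRel ends l o ζ (blue (flipO ends ζ l o)) := by
  rw [mem_src_principal] at hζ
  have hB : o ∈ bside ends ζ l := bside_of_mem_src hζ
  have hnc : NonCritRed ends (blue ζ) l (piece ends ζ l o) :=
    nonCritRed_of_core_eq (ζ := blue ζ) (by rw [core_blue]; exact hK ζ) _
  have hp : piece ends (blue (flipO ends ζ l o)) l o = piece ends ζ l o := by
    rw [piece_blue]; exact (flipO_blue_case hB hnc).2.1
  refine ⟨fun e he => ?_, fun e he => ?_, fun e he => Or.inl (mem_touches_piece_of_agree he)⟩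
  · rw [hp, Set.inter_self] at he
    exact agree_of_mem_touches_piece he
  · obtain ⟨x, hx, y, hends⟩ := he
    rw [Set.mem_singleton_iff] at hx
    subst hx
    exact agree_of_mem_touches_piece ⟨x, mem_piece_self ζ l x, y, hends⟩

/-- **(PAIR-combo) on the trivial-core class**: if every configuration has core `{l}`, the swap of
the piece flip is a piece-confined pairing of the principal source set. -/
theorem pairCombo_of_core_eq (ends : E → Sym2 V) (l h o : V)
    (hK : ∀ ζ : Config E, core ends ζ l = {l}) : PairCombo ends l h o := by
  refine ⟨fun x => ⟨blue (flipO ends x.1 l o), blue_flipO_mem_src hK x.2⟩, ?_, ?_⟩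
  · intro x
    exact Subtype.ext (blue_flipO_blue_flipO hK x.2)
  · intro x
    exact ⟨pairRel_blue_flipO x.2, comboRel_blue_flipO hK x.2⟩

/-! ## A root with at most one incident edge -/

omit [Fintype E] [DecidableEq E] in
/-- The cluster of a vertex with no open incident edge is the singleton. -/
lemma cluster_eq_singleton_of_no_open_edge {ω : Config E} {v : V}
    (hv : ∀ e, ω e = true → v ∉ ends e) : cluster ends ω v = {v} := by
  apply Set.Subset.antisymm
  · intro u hu
    refine mem_of_conn_of_closed (ends := ends) (ω := ω) (S := {v}) ?_ rfl hu
    intro a ha b hab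
    rw [Set.mem_singleton_iff] at ha
    subst ha
    obtain ⟨_, e, he, hends⟩ := exists_edge_of_adj hab
    exact absurd (by rw [hends]; exact Sym2.mem_mk_left a b) (hv e he)
  · intro u hu
    rw [Set.mem_singleton_iff] at hu
    subst hu
    exact mem_cluster_self _ _ _

omit [Fintype E] [DecidableEq E] in
/-- A root with at most one incident edge has core `{l}` in every configuration. -/
lemma core_eq_of_edges_at_root (hl : ∀ e₁ e₂, l ∈ ends e₁ → l ∈ ends e₂ → e₁ = e₂)
    (ζ : Config E) : core ends ζ l = {l} := by
  apply Set.Subset.antisymm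
  · intro k hk
    by_cases hex : ∃ e, l ∈ ends e
    · obtain ⟨e, he⟩ := hex
      cases hc : ζ e with
      | true =>
        -- the only edge at `l` is red: the blue cluster of `l` is `{l}`
        have hB : cluster ends (blue ζ) l = {l} :=
          cluster_eq_singleton_of_no_open_edge (fun e' he' hl' => by
            have := hl e' e hl' he
            subst this
            rw [blue_eq_true_iff] at he'
            rw [he'] at hc
            exact Bool.false_ne_true hc)
        rw [mem_core_iff, hB] at hk
        exact hk.2
      | false =>
        have hR : cluster ends ζ l = {l} :=
          cluster_eq_singleton_of_no_open_edge (fun e' he' hl' => by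
            have := hl e' e hl' he
            subst this
            rw [he'] at hc
            exact Bool.noConfusion hc)
        rw [mem_core_iff, hR] at hk
        exact hk.1
    · have hR : cluster ends ζ l = {l} :=
        cluster_eq_singleton_of_no_open_edge (fun e' _ hl' => hex ⟨e', hl'⟩)
      rw [mem_core_iff, hR] at hk
      exact hk.1
  · intro k hk
    rw [Set.mem_singleton_iff] at hk
    subst hk
    exact l_mem_core ζ k

/-- **(PAIR-combo) when the root has at most one incident edge.** -/
theorem pairCombo_of_edges_at_root (ends : E → Sym2 V) (l h o : V)
    (hl : ∀ e₁ e₂, l ∈ ends e₁ → l ∈ ends e₂ → e₁ = e₂) : PairCombo ends l h o :=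
  pairCombo_of_core_eq ends l h o (core_eq_of_edges_at_root hl)

end LocRows

end Summit.Ventures.PercRepro2
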